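import Summits.ABC.IUTFork.Cor312LicenceTripleUnconditional
import Summits.ABC.IUTFork.Conditional.AbcOfSGenuineKWildInhabitedRow283
import HarnessLib

/-!
# R-W WINDOW-TABLE «W:INHABITED-BANDS-A» — the abc triple `283 + 5¹¹·13² = 2⁸·3⁸·17³` at EVERY prime level `l ≥ 13`: the hull licence S_H HOLDS at
# EVERY genuine Θ-volume datum over `(ratPoint (283/8251953408), l)`, unconditionally — ONE theorem for all 73 open rows of this triple

PROOF-ONLY file (D-0012; 0 definitions, 0 `Prop` facts) of the abc-iut cell — D-0079 RESCUE sub-cell R-W «WINDOW Θ-SIDE INEQUALITY», W1 ROW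
DECISIONS composer seat abc-iut-W-row-1 (gen 2), claim «W:INHABITED-BANDS-A» (abc-iut-plan ruling C-R75). The R-W numerics lead's open list
(HOME/plan/rescue/R-W/OPEN-INHABITED-ROUTE.tsv) carries 73 rows `pilotDataOfK:frey-283-8251953125-8251953408:l` (13 ≤ l ≤ 397); this file decides
ALL of them — and every other prime level `l ≥ 13` — on the INHABITED side by ONE theorem, instantiating this seat's unconditional triple socket
`WRow.licence_triple_unconditional` (`Cor312LicenceTripleUnconditional`, p485974) at a SYMBOLIC level `l`: the socket's arithmetic hypothesis
`hcell` is discharged uniformly in `l` — per bad prime `p` the admissible ramification indices are `e = m_p·l·n` (coprimality of the prime `l ≥ 13`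
to the small constants), `e` is off the cyclotomic indices (an auxiliary prime `5` or `3` divides `e`), and with ONE FIXED envelope exponent per
prime (A_3 = 5, A_5 = 4, A_13 = 1, A_17 = 1, A_283 = 0) the two floor-free END-LABEL cells (`WRow.cell_wild_of_ends` / `_tame_of_ends`, p485154) are quadratics in `L = (l−1)/2` with
ALL coefficients negative (`nlinarith`). TAKES NO SIDE on [IUTchIII] Cor. 3.12 (S. Mochizuki, *Inter-universal Teichmüller theory III*, Cor. 3.12
p. 173–174; Step (xi-f) p. 184) or on any author; «inhabited as typed» ≠ «asserted in print».

WHAT IS PROVED (namespace `Summit.ABC.IUTFork.Conditional`): `WRow.hcell_frey283_all` (the arithmetic, every prime `l ≥ 13`), **`WRow.licence_frey283_all`** — for EVERY prime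
`l ≥ 13`, EVERY genuine Θ-volume datum `T` at `(ratPoint (283/8251953408), l)` and EVERY pair of realising Θ- and q-ideles, abc-iut-c312-1's
`Thm311ToCor312.Licence` HOLDS at `settingPrVolSharp (pilotDataOfK T.D T.K) …`; **`WRow.exists_qPinned_and_hull_frey283_all`** — branch C's «∃ ρ qK, QPinned ∧
PilotKummerCompatHull» there, any columns. READING (neutral; numbers, not adjectives): the per-datum S_H object of the window certificates' binder
`hSHwBad` (p453137 / p450130) is INHABITED at the whole datum class for every prime level `l ≥ 13`; no number-level and no local-type hypothesis is
consumed. Admissibility / (P6) / Szpiro-badness of `(ratPoint λ, l)` and NON-EMPTINESS of the datum type are NOT claimed (at most finitely many `l`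
carry genuine data at all). HONEST SCOPE: OUR sharp containers; STRONGER-THAN-PRINT hull reading; nothing about the printed inequality or any
author's intended hull; typed ≠ proved; instantiated ≠ endorsed; no abc claim.
[cite: Mochizuki2012, IUTchI Def. 3.1 (b),(c) pp. 61–62, Rmk. 3.1.5 p. 65, Ex. 3.2 (iv) p. 71; IUTchIII Cor. 3.12 Step (xi-f) p. 184; IUTchIV Prop. 1.1 p. 9, Prop. 1.2 (i)(ii) p. 10, Prop. 1.4 (ii) p. 13, Cor. 2.2 (ii) proof (P5) p. 46]
[cite: DupuyHilado2025, §3.3, §3.4, §4.9, §4.12] [cite: NeukirchANT1999, Ch. II (5.5)–(5.7)] [claim: Mochizuki2012, status: disputed] for every IUT sentence.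
-/

noncomputable section

open Set Function Metric NumberField IsDedekindDomain

namespace Summit.ABC.IUTFork.Conditional

open Thm311 Thm311.Real Cor312 Cor312Vol Cor312Prov Literature.IUT.LogThetaLattice Literature.IUT.LogVolume
  Literature.IUT.HodgeTheaters Literature.IUT.LogVolume.Cor22
open Literature.NumberTheory.NumberFields Literature.NumberTheory.GaloisRepresentations.Ultrametric
open Literature.NumberTheory.DiophantineGeometry Literature.NumberTheory.DiophantineGeometry.GenEll


/-! ## The arithmetic at a symbolic prime level `l ≥ 13` -/

/-- **The socket's arithmetic hypothesis `hcell` for `(283, 8251953125, 8251953408)` at EVERY prime level `l ≥ 13`.** Per prime of `abc` other than `2, l`: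
the divisibilities the socket hands over force `e = m_p·l·n` (`n ≥ 1`), `e` is off the cyclotomic indices, and with the fixed exponents
A_3 = 5, A_5 = 4, A_13 = 1, A_17 = 1, A_283 = 0 the two end-label floor-free cells are quadratics in `(l−1)/2` with negative coefficients; all labels and multiples by
`WRow.cell_wild_of_ends` / `WRow.cell_tame_of_ends`. [folklore] -/
theorem WRow.hcell_frey283_all {l : ℕ} (hl : l.Prime) (hl0 : 13 ≤ l) :
    ∀ p : ℕ, p.Prime → p ∣ 283 * 8251953125 * 8251953408 → p ≠ 2 → p ≠ l → ∀ e : ℕ, 0 < e → l ∣ e →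
      15 * l ∣ e * (283 * 8251953125 * 8251953408).factorization p → (p ∣ 30 → (p - 1) ∣ e) →
      (p ∣ 8251953408 → Odd ((283 * 8251953125 * 8251953408).factorization p) → 30 * l ∣ e * (283 * 8251953125 * 8251953408).factorization p) →
      (∀ k : ℕ, (e : ℤ) ≠ (p : ℤ) ^ k * ((p : ℤ) - 1)) ∧
      ∀ i : ℕ, i < (l - 1) / 2 →
        (e : ℤ) * ((((i + 1 : ℕ) : ℤ) ^ 2 * ((e * (2 * (283 * 8251953125 * 8251953408).factorization p) / (2 * l) : ℕ) : ℤ) -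
            ((i + 1 : ℕ) : ℤ) * (((if p ∣ 30 ∧ ¬ p ∣ (283 * 8251953125 * 8251953408).factorization p then 2 * e - 1 else e - 1 : ℕ) : ℕ) : ℤ) -
            ((i + 2 : ℕ) : ℤ) * (if p ∣ 30 then (((e / (p - 1) : ℕ) : ℤ)) else (1 : ℤ))) / (e : ℤ)) +
          ((i + 2 : ℕ) : ℤ) * min ((p : ℤ) ^ (if p = 3 then 5 else if p = 5 then 4 else if p = 13 then 1 else if p = 17 then 1 else 0) - ((if p = 3 then 5 else if p = 5 then 4 else if p = 13 then 1 else if p = 17 then 1 else 0 : ℕ) : ℤ) * (e : ℤ))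
            ((p : ℤ) ^ (if p = 3 then 6 else if p = 5 then 5 else if p = 13 then 2 else if p = 17 then 2 else 1) - ((if p = 3 then 6 else if p = 5 then 5 else if p = 13 then 2 else if p = 17 then 2 else 1 : ℕ) : ℤ) * (e : ℤ)) ≤
        ((e * (2 * (283 * 8251953125 * 8251953408).factorization p) / (2 * l) : ℕ) : ℤ) := by
  intro p hp hpabc h2 hpl e he _hle h15 h30 hodd
  rcases eq_of_prime_dvd_triple_283 hp hpabc with rfl | rfl | rfl | rfl | rfl | rfl
  · exact absurd rfl h2
  · -- `p = 3`: `v_3(abc) = 8`, admissible `e = 30·l·n`, `A = 5`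
    rw [factorization_triple_283.1] at h15 hodd ⊢
    have hcopv : Nat.Coprime (15 * l) 8 :=
      Nat.Coprime.mul_left (by norm_num) ((Nat.Prime.coprime_iff_not_dvd hl).mpr (fun h => by have := Nat.le_of_dvd (by norm_num) h; omega))
    have hA : 15 * l ∣ e := hcopv.dvd_of_dvd_mul_right h15
    have hq : 2 ∣ e := by have := h30 (by norm_num); norm_num at this; exact this
    have hcopq : Nat.Coprime 2 (15 * l) :=
      Nat.Coprime.mul_right (by norm_num) ((Nat.coprime_primes (by norm_num) hl).mpr (by omega))
    have he0 : 30 * l ∣ e := by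
      have := Nat.Coprime.mul_dvd_of_dvd_of_dvd hcopq hq hA; rwa [← mul_assoc, show (2 : ℕ) * 15 = 30 by norm_num] at this
    obtain ⟨n, rfl⟩ := he0
    have hn : 1 ≤ n := Nat.pos_of_ne_zero (by rintro rfl; simp at he)
    refine ⟨WRow.natCast_ne_pow_mul_sub_one (by norm_num : Nat.Prime 5) (by norm_num) (by norm_num) (by norm_num)
      ⟨6 * l * n, by ring⟩, fun i hi => ?_⟩
    rw [if_pos ⟨by norm_num, by norm_num⟩, if_pos (by norm_num : (3 : ℕ) ∣ 30)]
    simp only [ite_true]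
    refine WRow.cell_wild_of_ends ((3 : ℕ) : ℤ) (30 * l) (3 - 1) (2 * 8) (2 * l) 5 6 ((l - 1) / 2) (by norm_num) (by norm_num)
      (Dvd.dvd.mul_right (by norm_num) l) (by omega) ⟨240, by ring⟩ (by omega) ?_ hi hn
    have hP : 30 * l * (2 * 8) / (2 * l) = 240 := Nat.div_eq_of_eq_mul_left (by omega) (by ring)
    have hR : 30 * l / (3 - 1) = 15 * l := by omega
    have hpA : (((3 : ℕ) : ℤ)) ^ 5 = 243 := by norm_num
    rintro i (rfl | hi')
    · rw [hP, hR, hpA]; push_cast; omega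
    · obtain ⟨k, hk⟩ := hl.odd_of_ne_two (by omega)
      have hl' : l = 2 * i + 3 := by omega
      subst hl'
      have hi0 : ((5 : ℕ) : ℤ) ≤ (i : ℤ) := by exact_mod_cast (show 5 ≤ i by omega)
      rw [hP, hR, hpA]; push_cast at hi0 ⊢
      nlinarith [sq_nonneg (i : ℤ), mul_nonneg (sub_nonneg.mpr hi0) (show (0 : ℤ) ≤ (i : ℤ) by positivity)]
  · -- `p = 5`: `v_5(abc) = 11`, admissible `e = 60·l·n`, `A = 4`
    rw [factorization_triple_283.2.1] at h15 hodd ⊢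
    have hcopv : Nat.Coprime (15 * l) 11 :=
      Nat.Coprime.mul_left (by norm_num) ((Nat.Prime.coprime_iff_not_dvd hl).mpr (fun h => by have := Nat.le_of_dvd (by norm_num) h; omega))
    have hA : 15 * l ∣ e := hcopv.dvd_of_dvd_mul_right h15
    have hq : 4 ∣ e := by have := h30 (by norm_num); norm_num at this; exact this
    have hcopq : Nat.Coprime 4 (15 * l) :=
      Nat.Coprime.mul_right (by norm_num) (by simpa using ((Nat.coprime_primes (by norm_num) hl).mpr (by omega) : Nat.Coprime 2 l).pow_left 2)
    have he0 : 60 * l ∣ e := by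
      have := Nat.Coprime.mul_dvd_of_dvd_of_dvd hcopq hq hA; rwa [← mul_assoc, show (4 : ℕ) * 15 = 60 by norm_num] at this
    obtain ⟨n, rfl⟩ := he0
    have hn : 1 ≤ n := Nat.pos_of_ne_zero (by rintro rfl; simp at he)
    refine ⟨WRow.natCast_ne_pow_mul_sub_one (by norm_num : Nat.Prime 3) (by norm_num) (by norm_num) (by norm_num)
      ⟨20 * l * n, by ring⟩, fun i hi => ?_⟩
    rw [if_pos ⟨by norm_num, by norm_num⟩, if_pos (by norm_num : (5 : ℕ) ∣ 30)]
    simp only [show ((5 : ℕ) = 3) = False from eq_false (by decide), ite_true, ite_false]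
    refine WRow.cell_wild_of_ends ((5 : ℕ) : ℤ) (60 * l) (5 - 1) (2 * 11) (2 * l) 4 5 ((l - 1) / 2) (by norm_num) (by norm_num)
      (Dvd.dvd.mul_right (by norm_num) l) (by omega) ⟨660, by ring⟩ (by omega) ?_ hi hn
    have hP : 60 * l * (2 * 11) / (2 * l) = 660 := Nat.div_eq_of_eq_mul_left (by omega) (by ring)
    have hR : 60 * l / (5 - 1) = 15 * l := by omega
    have hpA : (((5 : ℕ) : ℤ)) ^ 4 = 625 := by norm_num
    rintro i (rfl | hi')
    · rw [hP, hR, hpA]; push_cast; omega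
    · obtain ⟨k, hk⟩ := hl.odd_of_ne_two (by omega)
      have hl' : l = 2 * i + 3 := by omega
      subst hl'
      have hi0 : ((5 : ℕ) : ℤ) ≤ (i : ℤ) := by exact_mod_cast (show 5 ≤ i by omega)
      rw [hP, hR, hpA]; push_cast at hi0 ⊢
      nlinarith [sq_nonneg (i : ℤ), mul_nonneg (sub_nonneg.mpr hi0) (show (0 : ℤ) ≤ (i : ℤ) by positivity)]
  · -- `p = 13`: `v_13(abc) = 2`, admissible `e = 15·l·n`, `A = 1`
    rw [factorization_triple_283.2.2.1] at h15 hodd ⊢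
    have hcopv : Nat.Coprime (15 * l) 2 :=
      Nat.Coprime.mul_left (by norm_num) ((Nat.Prime.coprime_iff_not_dvd hl).mpr (fun h => by have := Nat.le_of_dvd (by norm_num) h; omega))
    have hA : 15 * l ∣ e := hcopv.dvd_of_dvd_mul_right h15
    obtain ⟨n, rfl⟩ := hA
    have hn : 1 ≤ n := Nat.pos_of_ne_zero (by rintro rfl; simp at he)
    refine ⟨WRow.natCast_ne_pow_mul_sub_one (by norm_num : Nat.Prime 5) (by norm_num) (by norm_num) (by norm_num)
      ⟨3 * l * n, by ring⟩, fun i hi => ?_⟩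
    rw [if_neg (by norm_num : ¬ ((13 : ℕ) ∣ 30 ∧ ¬ (13 : ℕ) ∣ 2)), if_neg (by norm_num : ¬ (13 : ℕ) ∣ 30)]
    simp only [show ((13 : ℕ) = 3) = False from eq_false (by decide), show ((13 : ℕ) = 5) = False from eq_false (by decide), ite_true, ite_false]
    refine WRow.cell_tame_of_ends ((13 : ℕ) : ℤ) (15 * l) (2 * 2) (2 * l) 1 2 ((l - 1) / 2) (by norm_num) (by omega)
      ⟨30, by ring⟩ (by omega) ?_ hi hn
    have hP : 15 * l * (2 * 2) / (2 * l) = 30 := Nat.div_eq_of_eq_mul_left (by omega) (by ring)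
    have hpA : (((13 : ℕ) : ℤ)) ^ 1 = 13 := by norm_num
    rintro i (rfl | hi')
    · rw [hP, hpA]; push_cast; omega
    · obtain ⟨k, hk⟩ := hl.odd_of_ne_two (by omega)
      have hl' : l = 2 * i + 3 := by omega
      subst hl'
      have hi0 : ((5 : ℕ) : ℤ) ≤ (i : ℤ) := by exact_mod_cast (show 5 ≤ i by omega)
      rw [hP, hpA]; push_cast at hi0 ⊢
      nlinarith [sq_nonneg (i : ℤ), mul_nonneg (sub_nonneg.mpr hi0) (show (0 : ℤ) ≤ (i : ℤ) by positivity)]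
  · -- `p = 17`: `v_17(abc) = 3`, admissible `e = 10·l·n`, `A = 1`
    rw [factorization_triple_283.2.2.2] at h15 hodd ⊢
    have h15' : 5 * l * 3 ∣ e * 1 * 3 := by
      rw [show 5 * l * 3 = 15 * l by ring, show e * 1 * 3 = e * 3 by ring]; exact h15
    have hA : 5 * l ∣ e := by have := Nat.dvd_of_mul_dvd_mul_right (by norm_num) h15'; simpa using this
    have hT : 10 * l ∣ e := by
      have h := hodd (by norm_num) (by decide)
      rw [show 30 * l = 10 * l * 3 by ring, show e * 3 = e * 1 * 3 by ring] at h
      have h' := Nat.dvd_of_mul_dvd_mul_right (by norm_num) h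
      simpa using h'
    have he0' : 10 * l ∣ e := hT
    obtain ⟨n, rfl⟩ := he0'
    have hn : 1 ≤ n := Nat.pos_of_ne_zero (by rintro rfl; simp at he)
    refine ⟨WRow.natCast_ne_pow_mul_sub_one (by norm_num : Nat.Prime 5) (by norm_num) (by norm_num) (by norm_num)
      ⟨2 * l * n, by ring⟩, fun i hi => ?_⟩
    rw [if_neg (by norm_num : ¬ ((17 : ℕ) ∣ 30 ∧ ¬ (17 : ℕ) ∣ 3)), if_neg (by norm_num : ¬ (17 : ℕ) ∣ 30)]
    simp only [show ((17 : ℕ) = 3) = False from eq_false (by decide), show ((17 : ℕ) = 5) = False from eq_false (by decide), show ((17 : ℕ) = 13) = False from eq_false (by decide), ite_true, ite_false]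
    refine WRow.cell_tame_of_ends ((17 : ℕ) : ℤ) (10 * l) (2 * 3) (2 * l) 1 2 ((l - 1) / 2) (by norm_num) (by omega)
      ⟨30, by ring⟩ (by omega) ?_ hi hn
    have hP : 10 * l * (2 * 3) / (2 * l) = 30 := Nat.div_eq_of_eq_mul_left (by omega) (by ring)
    have hpA : (((17 : ℕ) : ℤ)) ^ 1 = 17 := by norm_num
    rintro i (rfl | hi')
    · rw [hP, hpA]; push_cast; omega
    · obtain ⟨k, hk⟩ := hl.odd_of_ne_two (by omega)
      have hl' : l = 2 * i + 3 := by omega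
      subst hl'
      have hi0 : ((5 : ℕ) : ℤ) ≤ (i : ℤ) := by exact_mod_cast (show 5 ≤ i by omega)
      rw [hP, hpA]; push_cast at hi0 ⊢
      nlinarith [sq_nonneg (i : ℤ), mul_nonneg (sub_nonneg.mpr hi0) (show (0 : ℤ) ≤ (i : ℤ) by positivity)]
  · -- `p = 283`: `v_283(abc) = 1`, admissible `e = 15·l·n`, `A = 0`
    rw [show (283 * 8251953125 * 8251953408 : ℕ).factorization 283 = 1 from by
      rw [show (283 * 8251953125 * 8251953408 : ℕ) = 283 ^ 1 * 68094732712500000000 by norm_num, Nat.factorization_mul (by positivity) (by norm_num),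
        Finsupp.add_apply, Nat.Prime.factorization_pow (by norm_num), Finsupp.single_eq_same,
        Nat.factorization_eq_zero_of_not_dvd (by norm_num), add_zero]] at h15 hodd ⊢
    have hA : 15 * l ∣ e := by simpa using h15
    obtain ⟨n, rfl⟩ := hA
    have hn : 1 ≤ n := Nat.pos_of_ne_zero (by rintro rfl; simp at he)
    refine ⟨WRow.natCast_ne_pow_mul_sub_one (by norm_num : Nat.Prime 5) (by norm_num) (by norm_num) (by norm_num)
      ⟨3 * l * n, by ring⟩, fun i hi => ?_⟩
    rw [if_neg (by norm_num : ¬ ((283 : ℕ) ∣ 30 ∧ ¬ (283 : ℕ) ∣ 1)), if_neg (by norm_num : ¬ (283 : ℕ) ∣ 30)]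
    simp only [show ((283 : ℕ) = 3) = False from eq_false (by decide), show ((283 : ℕ) = 5) = False from eq_false (by decide), show ((283 : ℕ) = 13) = False from eq_false (by decide), show ((283 : ℕ) = 17) = False from eq_false (by decide), ite_false]
    refine WRow.cell_tame_of_ends ((283 : ℕ) : ℤ) (15 * l) (2 * 1) (2 * l) 0 1 ((l - 1) / 2) (by norm_num) (by omega)
      ⟨15, by ring⟩ (by omega) ?_ hi hn
    have hP : 15 * l * (2 * 1) / (2 * l) = 15 := Nat.div_eq_of_eq_mul_left (by omega) (by ring)
    have hpA : (((283 : ℕ) : ℤ)) ^ 0 = 1 := by norm_num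
    rintro i (rfl | hi')
    · rw [hP, hpA]; push_cast; omega
    · obtain ⟨k, hk⟩ := hl.odd_of_ne_two (by omega)
      have hl' : l = 2 * i + 3 := by omega
      subst hl'
      have hi0 : ((5 : ℕ) : ℤ) ≤ (i : ℤ) := by exact_mod_cast (show 5 ≤ i by omega)
      rw [hP, hpA]; push_cast at hi0 ⊢
      nlinarith [sq_nonneg (i : ℤ), mul_nonneg (sub_nonneg.mpr hi0) (show (0 : ℤ) ≤ (i : ℤ) by positivity)]

/-! ## THE BAND: S_H INHABITED at every genuine datum over `(ratPoint (283/8251953408), l)`, every prime `l ≥ 13` -/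

/-- **«W:INHABITED-BANDS-A», `283 + 5¹¹·13² = 2⁸·3⁸·17³`: for EVERY prime `l ≥ 13`**, every genuine Θ-volume datum `T` at `(ratPoint (283/8251953408), l)`
([IUTchIV] Cor. 2.2 (ii) proof (P7)) and every pair of Θ- and q-ideles realising the pilot divisors of `X := pilotDataOfK T.D T.K`, abc-iut-c312-1's
`Thm311ToCor312.Licence` HOLDS at abc-iut-c312-7's `settingPrVolSharp X …` — `WRow.licence_triple_unconditional` at `WRow.hcell_frey283_all`.
[cite: Mochizuki2012, IUTchI Def. 3.1 (b),(c) pp. 61–62, Rmk. 3.1.5 p. 65, Ex. 3.2 (iv) p. 71; IUTchIII Cor. 3.12 Step (xi-f) p. 184; IUTchIV Prop. 1.1 p. 9, Prop. 1.2 (i)(ii) p. 10, Prop. 1.4 (ii) p. 13, Cor. 2.2 (ii) proof (P5) p. 46] [cite: DupuyHilado2025, §3.3, §3.4, §4.9, §4.12] [claim: Mochizuki2012, status: disputed] -/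
theorem WRow.licence_frey283_all (l : ℕ) (hl : l.Prime) (hl0 : 13 ≤ l) (T : Cor22.ThetaVolumeDatumAt (ratPoint (((283 : ℕ) : ℚ) / (8251953408 : ℕ))) l) :
    letI := T.instFieldF; letI := T.instNumberFieldF; letI := T.instAlgebraF; letI := T.instFieldK
    letI := T.instNumberFieldK; letI := T.instAlgebraK; letI := T.instFieldFbar; letI := T.instAlgebraFbar
    letI := T.instAlgebraKFbar; letI := T.instIsElliptic
    ∀ {logv : PadicLogs T.K} (hlog : LogvAnalytic logv) (M : Type) [Field M] [NumberField M]
      (archPk : ∀ (j : (thetaIndex (pilotDataOfK T.D T.K)).Label) (vQ : (thetaIndex (pilotDataOfK T.D T.K)).VQ),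
        Set ((logShellsDH (pilotDataOfK T.D T.K) logv).Packet j vQ))
      (archSub : ∀ (j : (thetaIndex (pilotDataOfK T.D T.K)).Label) (v : (thetaIndex (pilotDataOfK T.D T.K)).V),
        Set ((logShellsDH (pilotDataOfK T.D T.K) logv).Packet j ((thetaIndex (pilotDataOfK T.D T.K)).over v)))
      (Ψ : ℤ → ∀ v : (thetaIndex (pilotDataOfK T.D T.K)).V, v ∈ (thetaIndex (pilotDataOfK T.D T.K)).Vbad →
        Set ((logShellsDH (pilotDataOfK T.D T.K) logv).StarPacket v))
      (act : ℤ → ∀ v : (thetaIndex (pilotDataOfK T.D T.K)).V, v ∈ (thetaIndex (pilotDataOfK T.D T.K)).Vbad →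
        (logShellsDH (pilotDataOfK T.D T.K) logv).StarPacket v → Module.End ℚ ((logShellsDH (pilotDataOfK T.D T.K) logv).StarPacket v))
      (Mmod : ℤ → ∀ j : (thetaIndex (pilotDataOfK T.D T.K)).LabelStar, Set ((logShellsDH (pilotDataOfK T.D T.K) logv).GlobalPacket j.1))
      (region : ℤ → ∀ j : (thetaIndex (pilotDataOfK T.D T.K)).LabelStar, FinDivisor M → ∀ vQ : (thetaIndex (pilotDataOfK T.D T.K)).VQ,
        Set ((logShellsDH (pilotDataOfK T.D T.K) logv).Packet j.1 vQ))
      (n : ℤ) {HT : Type} {LogLink : HT → HT → Type} {IsFull : ∀ {s t : HT}, LogLink s t → Prop}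
      (lat : LGPGaussianLogThetaLattice LogLink IsFull)
      {Frd : Type} {IsoF : Frd → Frd → Type} {Ob : Frd → Type} {realify : Frd → Frd} {Strip : Type}
      {IsoS : Strip → Strip → Type} {Mv : ∀ v : (thetaIndex (pilotDataOfK T.D T.K)).V, v ∈ (thetaIndex (pilotDataOfK T.D T.K)).Vbad → Type}
      [∀ v h, Monoid (Mv v h)]
      (sig : GlobalLGPFrobenioidSignature (thetaIndex (pilotDataOfK T.D T.K)).lstar (thetaIndex (pilotDataOfK T.D T.K)).V
        (· ∈ (thetaIndex (pilotDataOfK T.D T.K)).Vbad) Frd IsoF Ob realify Strip IsoS Mv)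
      (split : SplittingMonoids Mv) {ObΔ : Type} {N : ∀ v : (thetaIndex (pilotDataOfK T.D T.K)).V, v ∈ (thetaIndex (pilotDataOfK T.D T.K)).Vbad → Type}
      [∀ v h, Monoid (N v h)] (qData : QPilotData ObΔ N)
      (tq : ∀ (pp : Nat.Primes) (x : (thetaIndex (pilotDataOfK T.D T.K)).Fibre (.inr pp)),
        haveI : Fact (pp : ℕ).Prime := ⟨pp.2⟩; kOf (pilotDataOfK T.D T.K) pp.1 x)
      (t : ∀ (pp : Nat.Primes) (_ : Fin (pilotDataOfK T.D T.K).lstar) (x : (thetaIndex (pilotDataOfK T.D T.K)).Fibre (.inr pp)),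
        haveI : Fact (pp : ℕ).Prime := ⟨pp.2⟩; kOf (pilotDataOfK T.D T.K) pp.1 x)
      (htq0 : ∀ pp x, tq pp x ≠ 0)
      (htq1 : ∀ (pp : Nat.Primes) (x : (thetaIndex (pilotDataOfK T.D T.K)).Fibre (.inr pp)),
        haveI : Fact (pp : ℕ).Prime := ⟨pp.2⟩; placeOf (pilotDataOfK T.D T.K) pp.1 x ∉ (pilotDataOfK T.D T.K).S → ‖tq pp x‖ = 1)
      (_ht0 : ∀ pp i x, t pp i x ≠ 0)
      (_ht : ∀ (pp : Nat.Primes) (i : Fin (pilotDataOfK T.D T.K).lstar) (x : (thetaIndex (pilotDataOfK T.D T.K)).Fibre (.inr pp)),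
        haveI : Fact (pp : ℕ).Prime := ⟨pp.2⟩
        Real.log ‖t pp i x‖ = -((pilotDataOfK T.D T.K).thetaPilot i (placeOf (pilotDataOfK T.D T.K) pp.1 x)) *
          logNorm T.K (placeOf (pilotDataOfK T.D T.K) pp.1 x) / localDegree T.K (placeOf (pilotDataOfK T.D T.K) pp.1 x))
      (_htq : ∀ (pp : Nat.Primes) (x : (thetaIndex (pilotDataOfK T.D T.K)).Fibre (.inr pp)),
        haveI : Fact (pp : ℕ).Prime := ⟨pp.2⟩
        Real.log ‖tq pp x‖ = -((pilotDataOfK T.D T.K).qPilot (placeOf (pilotDataOfK T.D T.K) pp.1 x)) *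
          logNorm T.K (placeOf (pilotDataOfK T.D T.K) pp.1 x) / localDegree T.K (placeOf (pilotDataOfK T.D T.K) pp.1 x)),
      Thm311ToCor312.Licence
        (settingPrVolSharp (pilotDataOfK T.D T.K) hlog M archPk archSub Ψ act Mmod region n lat sig split qData tq t htq0 htq1) :=
  WRow.licence_triple_unconditional isABCTriple_frey283 (by rw [Cor22.jInv_ratPoint_triple isABCTriple_frey283]; norm_num) T
    (fun p => if p = 3 then 5 else if p = 5 then 4 else if p = 13 then 1 else if p = 17 then 1 else 0) (fun p => if p = 3 then 6 else if p = 5 then 5 else if p = 13 then 2 else if p = 17 then 2 else 1) (WRow.hcell_frey283_all hl hl0)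

/-- **BRANCH C's PER-DATUM ANTECEDENT «∃ ρ qK, QPinned ∧ PilotKummerCompatHull» at every genuine datum over `(ratPoint (283/8251953408), l)`, EVERY prime
`l ≥ 13`** (any columns `col`; every pair of realising Θ- and q-ideles, the CHOSEN ones of the window certificates' `hSHw`/`hSHwBad` binders
included): the per-datum S_H object of the certificates of record (p453137 / p450130 / p447945) HOLDS at every such datum class, UNCONDITIONALLY.
[cite: Mochizuki2012, IUTchIII Cor. 3.12 Step (xi-d) p. 183, (xi-f) p. 184] [cite: DupuyHilado2025, §3.3, §3.4, §4.9] [claim: Mochizuki2012, status: disputed] -/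
theorem WRow.exists_qPinned_and_hull_frey283_all (l : ℕ) (hl : l.Prime) (hl0 : 13 ≤ l) (T : Cor22.ThetaVolumeDatumAt (ratPoint (((283 : ℕ) : ℚ) / (8251953408 : ℕ))) l) :
    letI := T.instFieldF; letI := T.instNumberFieldF; letI := T.instAlgebraF; letI := T.instFieldK
    letI := T.instNumberFieldK; letI := T.instAlgebraK; letI := T.instFieldFbar; letI := T.instAlgebraFbar
    letI := T.instAlgebraKFbar; letI := T.instIsElliptic
    ∀ {logv : PadicLogs T.K} (hlog : LogvAnalytic logv) (M : Type) [Field M] [NumberField M]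
      (archPk : ∀ (j : (thetaIndex (pilotDataOfK T.D T.K)).Label) (vQ : (thetaIndex (pilotDataOfK T.D T.K)).VQ),
        Set ((logShellsDH (pilotDataOfK T.D T.K) logv).Packet j vQ))
      (archSub : ∀ (j : (thetaIndex (pilotDataOfK T.D T.K)).Label) (v : (thetaIndex (pilotDataOfK T.D T.K)).V),
        Set ((logShellsDH (pilotDataOfK T.D T.K) logv).Packet j ((thetaIndex (pilotDataOfK T.D T.K)).over v)))
      (Ψ : ℤ → ∀ v : (thetaIndex (pilotDataOfK T.D T.K)).V, v ∈ (thetaIndex (pilotDataOfK T.D T.K)).Vbad →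
        Set ((logShellsDH (pilotDataOfK T.D T.K) logv).StarPacket v))
      (act : ℤ → ∀ v : (thetaIndex (pilotDataOfK T.D T.K)).V, v ∈ (thetaIndex (pilotDataOfK T.D T.K)).Vbad →
        (logShellsDH (pilotDataOfK T.D T.K) logv).StarPacket v → Module.End ℚ ((logShellsDH (pilotDataOfK T.D T.K) logv).StarPacket v))
      (Mmod : ℤ → ∀ j : (thetaIndex (pilotDataOfK T.D T.K)).LabelStar, Set ((logShellsDH (pilotDataOfK T.D T.K) logv).GlobalPacket j.1))
      (region : ℤ → ∀ j : (thetaIndex (pilotDataOfK T.D T.K)).LabelStar, FinDivisor M → ∀ vQ : (thetaIndex (pilotDataOfK T.D T.K)).VQ,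
        Set ((logShellsDH (pilotDataOfK T.D T.K) logv).Packet j.1 vQ))
      (n : ℤ) {HT : Type} {LogLink : HT → HT → Type} {IsFull : ∀ {s t : HT}, LogLink s t → Prop}
      (lat : LGPGaussianLogThetaLattice LogLink IsFull)
      {Frd : Type} {IsoF : Frd → Frd → Type} {Ob : Frd → Type} {realify : Frd → Frd} {Strip : Type}
      {IsoS : Strip → Strip → Type} {Mv : ∀ v : (thetaIndex (pilotDataOfK T.D T.K)).V, v ∈ (thetaIndex (pilotDataOfK T.D T.K)).Vbad → Type}
      [∀ v h, Monoid (Mv v h)]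
      (sig : GlobalLGPFrobenioidSignature (thetaIndex (pilotDataOfK T.D T.K)).lstar (thetaIndex (pilotDataOfK T.D T.K)).V
        (· ∈ (thetaIndex (pilotDataOfK T.D T.K)).Vbad) Frd IsoF Ob realify Strip IsoS Mv)
      (split : SplittingMonoids Mv) {ObΔ : Type} {N : ∀ v : (thetaIndex (pilotDataOfK T.D T.K)).V, v ∈ (thetaIndex (pilotDataOfK T.D T.K)).Vbad → Type}
      [∀ v h, Monoid (N v h)] (qData : QPilotData ObΔ N)
      (tq : ∀ (pp : Nat.Primes) (x : (thetaIndex (pilotDataOfK T.D T.K)).Fibre (.inr pp)),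
        haveI : Fact (pp : ℕ).Prime := ⟨pp.2⟩; kOf (pilotDataOfK T.D T.K) pp.1 x)
      (t : ∀ (pp : Nat.Primes) (_ : Fin (pilotDataOfK T.D T.K).lstar) (x : (thetaIndex (pilotDataOfK T.D T.K)).Fibre (.inr pp)),
        haveI : Fact (pp : ℕ).Prime := ⟨pp.2⟩; kOf (pilotDataOfK T.D T.K) pp.1 x)
      (htq0 : ∀ pp x, tq pp x ≠ 0)
      (htq1 : ∀ (pp : Nat.Primes) (x : (thetaIndex (pilotDataOfK T.D T.K)).Fibre (.inr pp)),
        haveI : Fact (pp : ℕ).Prime := ⟨pp.2⟩; placeOf (pilotDataOfK T.D T.K) pp.1 x ∉ (pilotDataOfK T.D T.K).S → ‖tq pp x‖ = 1)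
      (col : ℤ → Column (logShellsDH (pilotDataOfK T.D T.K) logv))
      (_ht0 : ∀ pp i x, t pp i x ≠ 0)
      (_ht : ∀ (pp : Nat.Primes) (i : Fin (pilotDataOfK T.D T.K).lstar) (x : (thetaIndex (pilotDataOfK T.D T.K)).Fibre (.inr pp)),
        haveI : Fact (pp : ℕ).Prime := ⟨pp.2⟩
        Real.log ‖t pp i x‖ = -((pilotDataOfK T.D T.K).thetaPilot i (placeOf (pilotDataOfK T.D T.K) pp.1 x)) *
          logNorm T.K (placeOf (pilotDataOfK T.D T.K) pp.1 x) / localDegree T.K (placeOf (pilotDataOfK T.D T.K) pp.1 x))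
      (_htq : ∀ (pp : Nat.Primes) (x : (thetaIndex (pilotDataOfK T.D T.K)).Fibre (.inr pp)),
        haveI : Fact (pp : ℕ).Prime := ⟨pp.2⟩
        Real.log ‖tq pp x‖ = -((pilotDataOfK T.D T.K).qPilot (placeOf (pilotDataOfK T.D T.K) pp.1 x)) *
          logNorm T.K (placeOf (pilotDataOfK T.D T.K) pp.1 x) / localDegree T.K (placeOf (pilotDataOfK T.D T.K) pp.1 x)),
      ∃ (ρ : (∀ v : (thetaIndex (pilotDataOfK T.D T.K)).V, v ∈ (thetaIndex (pilotDataOfK T.D T.K)).Vbad →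
              Set ((logShellsDH (pilotDataOfK T.D T.K) logv).StarPacket v)) →
            ∀ (j : (thetaIndex (pilotDataOfK T.D T.K)).Label) (vQ : (thetaIndex (pilotDataOfK T.D T.K)).VQ),
              Set ((logShellsDH (pilotDataOfK T.D T.K) logv).Packet j vQ))
          (qK : ∀ v : (thetaIndex (pilotDataOfK T.D T.K)).V, v ∈ (thetaIndex (pilotDataOfK T.D T.K)).Vbad →
            Set ((logShellsDH (pilotDataOfK T.D T.K) logv).StarPacket v)),
          QPinned ({ toSituation := situationPrVol (pilotDataOfK T.D T.K) hlog M archPk archSub Ψ act Mmod region, col := col } :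
              LatticeSituation (thetaIndex (pilotDataOfK T.D T.K)))
            (settingPrVolSharp (pilotDataOfK T.D T.K) hlog M archPk archSub Ψ act Mmod region n lat sig split qData tq t htq0 htq1) ρ qK ∧
          PilotKummerCompatHull ({ toSituation := situationPrVol (pilotDataOfK T.D T.K) hlog M archPk archSub Ψ act Mmod region, col := col } :
              LatticeSituation (thetaIndex (pilotDataOfK T.D T.K)))
            (settingPrVolSharp (pilotDataOfK T.D T.K) hlog M archPk archSub Ψ act Mmod region n lat sig split qData tq t htq0 htq1) ρ qK :=
  WRow.exists_qPinned_and_hull_triple_unconditional isABCTriple_frey283 (by rw [Cor22.jInv_ratPoint_triple isABCTriple_frey283]; norm_num) T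
    (fun p => if p = 3 then 5 else if p = 5 then 4 else if p = 13 then 1 else if p = 17 then 1 else 0) (fun p => if p = 3 then 6 else if p = 5 then 5 else if p = 13 then 2 else if p = 17 then 2 else 1) (WRow.hcell_frey283_all hl hl0)

end Summit.ABC.IUTFork.Conditional

end
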